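import Summits.RiemannHypothesis.RiemannHypothesis.Theses.SignCone
import Summits.RiemannHypothesis.RiemannHypothesis.Theorems.SignConeConeMagnificationStubFakePNT
import Summits.RiemannHypothesis.RiemannHypothesis.Theorems.SignConeConeMagnificationStubFakeMertens
import Summits.RiemannHypothesis.RiemannHypothesis.Theorems.SignConeConeMagnificationStubCombLocal
import Summits.RiemannHypothesis.RiemannHypothesis.Theorems.SignConeConeMagnificationStubCombZeroSideC
import Summits.RiemannHypothesis.RiemannHypothesis.Theorems.SignConeConeMagnificationCombInequalityDesign
import Summits.RiemannHypothesis.RiemannHypothesis.Theorems.SignConeConeMagnificationTypeConvergence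
import Summits.RiemannHypothesis.RiemannHypothesis.Theorems.SignConeSlackDesignStubCombNormAsymp
import Summits.RiemannHypothesis.RiemannHypothesis.Theorems.SignConeSlackDesignCombDiffGlue
import Summits.RiemannHypothesis.RiemannHypothesis.Theorems.SignConeSlackDesignPairDataGlue
import Summits.RiemannHypothesis.RiemannHypothesis.Theorems.SignConeConeMagnificationCombTypeSharpData
import Literature.NumberTheory.LFunctions.FiniteTypeInequalities
import Literature.NumberTheory.LFunctions.LogRieszWeights
import Literature.NumberTheory.LFunctions.WeilCombAutocorrelationBump

/-!
# `SignCone.SlackDesign` — line `real_comb_type` (crux strategist s1 r1; lead prover-line-stmt-RiemannHypothesis-18009-0 r2–r3)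
(item stmt-RiemannHypothesis-18009, route route-RiemannHypothesis-SignCone; unit
`cstrat-stmt-RiemannHypothesis-18009-s1`; line card `Lines/real_comb_type.md`)

CRUX (`SlackDesign`, zero-free analytic core of the 2001 magnification theorem W-MAG Thm 3.1 at unit slack):
a weight `c ≥ 0` on `ℕ`, `c 1 = 0`, with UNIT SLACK `-‖g‖₂² ≤ Re(W_ar(g⋆g̃) − P_c(g⋆g̃))` against every Weil
test `g` (+ two derivable data: `L`-summability on `re s > 1` and the Carathéodory majorant, UNUSED below) has the
DESIGN DATA (AX-A) `Σ|c−Λ|(n)/n < ∞`, (AX-B) composite mass summable, (AX-C) Riesz–Euler design inequality `≤ 1/2`.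

THE LINE.  Everything arithmetic is LANDED; what is open is US-FREE asymptotic evaluation of the node sums of the
`ζ`-mollified two-scale combs of the parent crux's line `Sketch` (window `h = √(log M)/M`, nodes `n ≤ 3LM`):

* (landed, p130740) `stub_fakePNT` : US ⇒ fake PNT with `O(1)` error;
* (landed, p147549/p148xxx) `stub_fakeMertens` : ⇒ Chebyshev `Σ_{n≤x} c ≤ Ax` ∧ Mertens `Σ_{n≤x} c/n − log x → C`;
* (landed, 08:40Z) `stub_combLocal` : ⇒ local summability `Σ_{p∣n} c(n)/n < ∞`;
* (landed, p149415) `combInequalityDesign` : US ⇒ for every REAL design `α` on `[1,L]`, bump `b`, `ε > 0`,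
  eventually in `M`: `Σ_{ℓ,ℓ'} α_ℓ α_ℓ' (E_c − E_Λ)(ℓ,ℓ') ≤ ((1+ε)/2)·Σ_{ℓ,ℓ'} α_ℓ α_ℓ' V_{ℓℓ'}(1)` — THE ONLY PLACE
  UNIT SLACK (the Weil functional, `ζ`, its zeros) ENTERS;
* **`stub_combNormAsymp`** (OPEN, c-free analysis, size M): `Σ αα' V_{ℓℓ'}(1) / log M → B(0)·Φ_α(1)`,
  `B(0) = ∫ b²`, `Φ_α` the [CV] gcd form (node evaluation at `n = 1`: diagonal count `(g/ℓ)H(⌊K₀g/ℓ⌋) ∼ (g/ℓ)log M`,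
  smooth count `O(√log M)`, landed per-node error `O(1)` — all `o(log M)`);
* **`stub_combDiffAsymp`** (OPEN, THE HARDEST: the sharp comb evaluation against `d = c − Λ`, size L): for `c ≥ 0`
  with Chebyshev, Mertens and local summability (NO unit slack):
  `Σ αα'(E_c − E_Λ)(ℓ,ℓ')/log M − B(0)·Σ_{n<M} (d(n)/n)·Φ_α(n)·(1 − log n/log M)₊ → 0`.
  Needs the REFINED node evaluation: the landed `node_weight_pair` error `O(1/n + h)` per node sums to `O(log M)`
  against `c + Λ` (same order as the main term); the truth (lead's COMB-EVALUATION.md §2, numerically validated)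
  is main term + a CLASS-PERIODIC secondary term `C_b·gcd(nℓ',ℓ)/(n√(ℓℓ'))·𝟙[deep comb]` (bounded against `d` by
  Abel summation with the convergent gcd-class sums) + errors `O(h)` per node (`O(√log M)` in total);
* (glue, proved below) comb inequality + the two asymptotics + `ε`-bookkeeping ⇒ the FINITE log-Riesz type
  inequalities for real designs ⇒ (`TypeDesign.typeLimit_le_of_eventually_le`, `logRiesz_regular`, landed) the bound
  `T ≤ ½Φ_β(1)` on the type limits of real designs ⇒ (`TypeIneq.typeOfRealLimitBound`, landed: real ⇒ complex,
  limits exist from Mertens + Loc) the type inequalities ⇒ (`TypeDesign.designData_of_mertens_typeBound`, landed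
  [CV]/W-MAG design algebra) AX-A ∧ AX-B ∧ AX-C(1/2) = the crux, BY NAME.

Also proved below (no stub): `SlackDesign_of_combType` — the crux from the parent line's registered open stub
`stub_combType` (Cruxes/ConeMagnification/Lines/Sketch.lean r8) VERBATIM as a hypothesis: whichever of
{`stub_combType` (parent lead), `stub_combNormAsymp` + `stub_combDiffAsymp` (this line)} lands first closes item 18009.

LEAD'S REVISIONS.  r2: bump nonnegativity `0 ≤ b` added to stubs N and D (the landed node machinery is stated for it; the
composition's `exists_real_bump` supplies it).  r3 (this file): `stub_combNormAsymp` LANDED (p158627, worker, from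
`CombType.norm_node_eval`) and is imported; `stub_combDiffAsymp` is PROVED here from the landed glue `combDiffAsymp_of_pairData`
(p158652: both cut-off families — harmonic `H(⌊X_M/(nℓ')⌋/(ℓ/δ))/log M` and log-Riesz `(1 − log n/log M)₊` — are regular, so the
weighted gcd-class sums share the class limit) and ONE new registered stub **`stub_pairData`** = the PAIR-LEVEL SHARP NODE DATA
for a Chebyshev–Mertens weight: exactly the middle conjunct of the parent crux's interface `CombType.combType_of_pairData` (p154004)
with `B₀ = ∫ b²`, i.e. the residual to which seat-0 reduced `stub_combType` on stmt-16303 (their node lemmas I–VIII′ landed: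
`…CombTypeFamilies/FamilyApprox/PeriodIntegral/FamilySums/NodeLemmas/NodeParams/NodeMain/NodeCorner`; what remains is the
node → pair summation of their raw bounds against `c + Λ`).  Both cruxes close from `stub_pairData`.
r4 (this file): `stub_pairData` PROVED from the landed glue `pairData_of_sharpNodeData` (node → pair summation by
`CombType.pair_difference_of_node_bounds`, `B(0) = ∫b²`, `1/(4h) = X_M`, `√(log M) ≤ (log M)^{3/4}`) and ONE registered stub
**`stub_sharpNodeData`** whose statement is the parent anchor `combTypeSharpNodeData` (stmt-16303, registered 11:53Z by seat-0, being
proved there) VERBATIM: the SHARP NODE DATA of the `ζ`-mollified comb for an arbitrary `C²` bump package `B` and Chebyshev weight `c`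
(per-node decomposition `V(n) = B(0)√(ℓ/ℓ')D(n)/n + hβ_h√(ℓ'/ℓ)N(n) + S(gcd(nℓ',ℓ))/n + err(n)` on `n ≤ 3LM` with `|S| ≤ E₁(log M)^{3/4}` and
`Σ(c+Λ)err ≤ E₁(log M)^{3/4}`).  Whichever seat lands it first: import, delete the local copy, propose this file `--workitem 18009`.
FINAL (this file, sorry-free): seat-0 landed `CombType.combTypeSharpNodeData` (…CombTypeSharpData, 12:2xZ) minutes before the lead's own
assembly of the same statement (work/stubs/SharpNodeData.lean, rc 0, bounced only as `dedup.landed`); it is imported, and the chain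
`SlackDesign_of ⟸ realLimitBound ⟸ {stub_combNormAsymp p158627, stub_combDiffAsymp ⟸ combDiffAsymp_of_pairData p158652 ⟸ stub_pairData ⟸
pairData_of_sharpNodeData p159195 ⟸ combTypeSharpNodeData}` closes the crux BY NAME with no sorry.
-/

noncomputable section

-- `Summit.RiemannHypothesis.RiemannHypothesis.…` repeats a namespace component by design (D-0017 layout).
set_option linter.dupNamespace false

open scoped BigOperators ComplexConjugate Topology ArithmeticFunction.vonMangoldt
open Complex MeasureTheory Set Filter

namespace Summit.RiemannHypothesis.RiemannHypothesis.Cruxes.SlackDesign.RealCombType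

open Literature.NumberTheory.LFunctions
open Summit.RiemannHypothesis.RiemannHypothesis.Theorems.SignConeConeMagnification
open Summit.RiemannHypothesis.RiemannHypothesis.Theorems.SignConeSlackDesign

/-! ### The registered stubs (signatures over existing declarations only) -/

-- Stub N `stub_combNormAsymp` (r1–r2): LANDED p158627 as
-- `Summit.RiemannHypothesis.RiemannHypothesis.Theorems.SignConeSlackDesign.stub_combNormAsymp` (imported, used below by name).

-- Stub S `stub_sharpNodeData` (r4): LANDED by the parent crux's seat-0 as
-- `Summit.RiemannHypothesis.RiemannHypothesis.Theorems.SignConeConeMagnification.CombType.combTypeSharpNodeData`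
-- (Theorems/SignConeConeMagnificationCombTypeSharpData.lean; identical statement), imported and used below by name.

/-- **Stub P — `pairData`** (r3 registered stub; PROVED from the parent's landed `CombType.combTypeSharpNodeData` by the landed glue
`pairData_of_sharpNodeData`).
For `c ≥ 0` with Chebyshev `Σ_{n≤x} c ≤ Ax` and Mertens `Σ_{n≤x} c/n − log x → C`, every `L ≥ 1` and every smooth bump `b ≥ 0`
on `[-1,1]`: for some `Cst` and `θ < 1`, eventually in `M`, for every pair `ℓ, ℓ' ≤ L` there is a class term `S` (a function of
`gcd(nℓ',ℓ)`, `|S| ≤ Cst(log M)^θ`) with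
`|(E_c − E_Λ)(ℓ,ℓ') − Σ_{n≤3LM} (c−Λ)(n)·((∫b²)√(ℓ/ℓ')·(Σ_{k'≤⌊X_M/(nℓ')⌋}[ℓ ∣ nℓ'k']/k')/n + S(gcd(nℓ',ℓ))/n)| ≤ Cst(log M)^θ`,
`E_f(ℓ,ℓ') = Σ_{n≤3LM} f(n)V_M(ℓ,ℓ',n)`, `X_M = M/(4√(log M))` — the middle conjunct of `CombType.combType_of_pairData`'s pair data
with `B₀ = ∫ b²` (inputs: seat-0's `CombType.node_sharp_main_raw`, `node_sharp_corner`, `pair_difference_of_node_bounds`,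
`sum_div_Ioc_le_of_chebyshev`). [folklore] -/
theorem stub_pairData :
    ∀ c : ℕ → ℝ, (∀ n, 0 ≤ c n) →
    (∃ A : ℝ, ∀ x : ℝ, 1 ≤ x → ∑ n ∈ Finset.Icc 1 ⌊x⌋₊, c n ≤ A * x) →
    (∃ C : ℝ, Filter.Tendsto (fun x : ℝ => (∑ n ∈ Finset.Icc 1 ⌊x⌋₊, c n / n) - Real.log x)
      Filter.atTop (nhds C)) →
    ∀ L : ℕ, 1 ≤ L →
    ∀ b : ℝ → ℝ, ContDiff ℝ (⊤ : ℕ∞) b → HasCompactSupport b → tsupport b ⊆ Set.Icc (-1) 1 → (∀ x, 0 ≤ b x) →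
    ∃ Cst θ : ℝ, θ < 1 ∧
      ∀ᶠ M : ℕ in Filter.atTop, ∀ ℓ ∈ Finset.Icc 1 L, ∀ ℓ' ∈ Finset.Icc 1 L,
        ∃ S : ℕ → ℝ,
          (∀ δ, |S δ| ≤ Cst * Real.log M ^ θ) ∧
          (|((∑ n ∈ Finset.Icc 1 (3 * L * M), c n *
                ∑ k' ∈ Finset.Icc 1 M,
                  (∑ k ∈ Finset.Icc 1 M, (∫ u, b u * b (u - (Real.log ((n : ℝ) * ℓ' * k' / ℓ) - Real.log k)
                    / (Real.sqrt (Real.log M) / M))) / Real.sqrt k) / Real.sqrt k' / Real.sqrt n) -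
              ∑ n ∈ Finset.Icc 1 (3 * L * M), (Λ n : ℝ) *
                ∑ k' ∈ Finset.Icc 1 M,
                  (∑ k ∈ Finset.Icc 1 M, (∫ u, b u * b (u - (Real.log ((n : ℝ) * ℓ' * k' / ℓ) - Real.log k)
                    / (Real.sqrt (Real.log M) / M))) / Real.sqrt k) / Real.sqrt k' / Real.sqrt n) -
            ∑ n ∈ Finset.Icc 1 (3 * L * M), (c n - Λ n) *
              ((∫ u, b u ^ 2) * (Real.sqrt ℓ / Real.sqrt ℓ') *
                  (∑ k' ∈ Finset.Icc 1 (⌊(M : ℝ) / (4 * Real.sqrt (Real.log M)) / ((n : ℝ) * ℓ')⌋₊),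
                    (if ℓ ∣ n * ℓ' * k' then (1 : ℝ) / k' else 0)) / n +
                S (Nat.gcd (n * ℓ') ℓ) / n)| ≤ Cst * Real.log M ^ θ) := by
  exact pairData_of_sharpNodeData CombType.combTypeSharpNodeData

/-- **Stub D — `combDiffAsymp`** (r1–r2 registered stub; r3: PROVED from `stub_pairData` and the landed glue
`combDiffAsymp_of_pairData` p158652 — the sharp comb evaluation against `c − Λ`; no unit slack, no Weil functional).  For `c ≥ 0` with Chebyshev and Mertens (conclusions of `stub_fakeMertens`,
verbatim) and local summability (conclusion of `stub_combLocal`, verbatim), a real design `α` on `[1, L]` and a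
smooth real bump `b ≥ 0` supported in `[-1,1]` (r2: `0 ≤ b` added — the landed node machinery is stated for it): the difference of the node sums of the `ζ`-mollified comb against `c`
and against `Λ`, divided by `log M`, is the `(∫ b²)`-multiple of the log-Riesz mean
`Σ_{n<M} ((c−Λ)(n)/n)·Φ_α(n)·(1 − log n/log M)₊` up to `o(1)` (`M → ∞`). [folklore] -/
theorem stub_combDiffAsymp :
    ∀ c : ℕ → ℝ, (∀ n, 0 ≤ c n) →
    ((∃ A : ℝ, ∀ x : ℝ, 1 ≤ x → ∑ n ∈ Finset.Icc 1 ⌊x⌋₊, c n ≤ A * x) ∧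
      (∃ C : ℝ, Filter.Tendsto (fun x : ℝ => (∑ n ∈ Finset.Icc 1 ⌊x⌋₊, c n / n) - Real.log x)
        Filter.atTop (nhds C))) →
    (∀ p : ℕ, p.Prime → Summable (fun n : ℕ => if p ∣ n then c n / n else 0)) →
    ∀ α : ℕ → ℝ, ∀ L : ℕ, (∀ m, L < m → α m = 0) → 1 ≤ L →
    ∀ b : ℝ → ℝ, ContDiff ℝ (⊤ : ℕ∞) b → HasCompactSupport b → tsupport b ⊆ Set.Icc (-1) 1 → (∀ x, 0 ≤ b x) →
    Filter.Tendsto (fun M : ℕ =>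
      ((∑ ℓ ∈ Finset.Icc 1 L, ∑ ℓ' ∈ Finset.Icc 1 L, α ℓ * α ℓ' *
          ∑ n ∈ Finset.Icc 1 (3 * L * M), c n *
            ∑ k' ∈ Finset.Icc 1 M,
              (∑ k ∈ Finset.Icc 1 M, (∫ u, b u * b (u - (Real.log ((n : ℝ) * ℓ' * k' / ℓ) - Real.log k)
                  / (Real.sqrt (Real.log M) / M))) / Real.sqrt k) / Real.sqrt k' / Real.sqrt n) -
        (∑ ℓ ∈ Finset.Icc 1 L, ∑ ℓ' ∈ Finset.Icc 1 L, α ℓ * α ℓ' *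
          ∑ n ∈ Finset.Icc 1 (3 * L * M), (Λ n : ℝ) *
            ∑ k' ∈ Finset.Icc 1 M,
              (∑ k ∈ Finset.Icc 1 M, (∫ u, b u * b (u - (Real.log ((n : ℝ) * ℓ' * k' / ℓ) - Real.log k)
                  / (Real.sqrt (Real.log M) / M))) / Real.sqrt k) / Real.sqrt k' / Real.sqrt n)) /
        Real.log M -
      (∫ u, b u ^ 2) * ∑ n ∈ Finset.range M, (c n - ArithmeticFunction.vonMangoldt n) / n *
        (∑ ℓ ∈ Finset.Icc 1 L, ∑ ℓ' ∈ Finset.Icc 1 L, ((α ℓ : ℝ) : ℂ) * (starRingEnd ℂ) ((α ℓ' : ℝ) : ℂ) *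
            (((Nat.gcd (n * ℓ') ℓ : ℕ) : ℝ) : ℂ) / (Real.sqrt ((ℓ : ℝ) * ℓ') : ℂ)).re *
        max (1 - Real.log n / Real.log M) 0)
      Filter.atTop (nhds 0) := by
  intro c hc0 hM hloc α L _hα hL b hb hbc hbs hb0
  obtain ⟨Cst, θ, hθ, hpd⟩ := stub_pairData c hc0 hM.1 hM.2 L hL b hb hbc hbs hb0
  exact combDiffAsymp_of_pairData c hc0 hM.2 hloc α hL (∫ u, b u ^ 2)
    (fun M ℓ ℓ' n => ∑ k' ∈ Finset.Icc 1 M,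
      (∑ k ∈ Finset.Icc 1 M, (∫ u, b u * b (u - (Real.log ((n : ℝ) * ℓ' * k' / ℓ) - Real.log k)
        / (Real.sqrt (Real.log M) / M))) / Real.sqrt k) / Real.sqrt k' / Real.sqrt n) hθ hpd

/-! ### Glue (sorry-free) -/

-- `logRiesz_one_regular` (r1 glue) is the landed `…Theorems.SignConeSlackDesign.logRiesz_one_regular'` (CombDiffGlue, p158652).

/-- **The bound on the type limits of REAL designs** from the comb inequality (landed) and the two asymptotic
stubs: for `c ≥ 0` with unit slack, Chebyshev/Mertens and local summability, every finitely supported real design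
`β` has type limit `T ≤ ½ Φ_β(1)`. [folklore] -/
theorem realLimitBound (c : ℕ → ℝ) (hc0 : ∀ n, 0 ≤ c n)
    (hU : ∀ g : ℝ → ℂ, IsWeilTest g →
      -(∫ t, ‖g t‖ ^ 2) ≤
        (weilPolarTerm (weilConv g (weilReflect g)) + weilArchTerm (weilConv g (weilReflect g)) -
          ∑' n : ℕ, ((c n : ℝ) : ℂ) / (Real.sqrt n : ℂ) *
            (weilConv g (weilReflect g) (Real.log n) + weilConv g (weilReflect g) (-Real.log n))).re)
    (hM : (∃ A : ℝ, ∀ x : ℝ, 1 ≤ x → ∑ n ∈ Finset.Icc 1 ⌊x⌋₊, c n ≤ A * x) ∧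
      (∃ C : ℝ, Filter.Tendsto (fun x : ℝ => (∑ n ∈ Finset.Icc 1 ⌊x⌋₊, c n / n) - Real.log x)
        Filter.atTop (nhds C)))
    (hloc : ∀ p : ℕ, p.Prime → Summable (fun n : ℕ => if p ∣ n then c n / n else 0)) :
    ∀ β : ℕ → ℝ, ∀ L : ℕ, (∀ m, L < m → β m = 0) → ∀ T : ℝ,
      Filter.Tendsto (fun x : ℝ => ∑ n ∈ Finset.Icc 1 ⌊x⌋₊,
          (c n - ArithmeticFunction.vonMangoldt n) / n *
            (∑ ℓ ∈ Finset.Icc 1 L, ∑ ℓ' ∈ Finset.Icc 1 L, ((β ℓ : ℝ) : ℂ) * (starRingEnd ℂ) ((β ℓ' : ℝ) : ℂ) *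
            (((Nat.gcd (n * ℓ') ℓ : ℕ) : ℝ) : ℂ) / (Real.sqrt ((ℓ : ℝ) * ℓ') : ℂ)).re) Filter.atTop (nhds T) →
        T ≤ 1 / 2 * (∑ ℓ ∈ Finset.Icc 1 L, ∑ ℓ' ∈ Finset.Icc 1 L, ((β ℓ : ℝ) : ℂ) * (starRingEnd ℂ) ((β ℓ' : ℝ) : ℂ) *
            (((Nat.gcd (1 * ℓ') ℓ : ℕ) : ℝ) : ℂ) / (Real.sqrt ((ℓ : ℝ) * ℓ') : ℂ)).re := by
  intro β L hβ T hT
  rcases Nat.eq_zero_or_pos L with hL0 | hLpos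
  · -- empty design: everything vanishes
    subst hL0
    have hIcc : Finset.Icc 1 0 = (∅ : Finset ℕ) := by decide
    simp only [hIcc, Finset.sum_empty, Complex.zero_re, mul_zero, Finset.sum_const_zero] at hT ⊢
    have := tendsto_nhds_unique hT tendsto_const_nhds
    rw [this]
  have hL : 1 ≤ L := hLpos
  -- a real bump with `∫ b² > 0`
  obtain ⟨b, hb, hbc, hbs, hb0, -, hB0⟩ := exists_real_bump
  set B0 : ℝ := ∫ u, b u ^ 2 with hB0def
  set Φ1 : ℝ := (∑ ℓ ∈ Finset.Icc 1 L, ∑ ℓ' ∈ Finset.Icc 1 L, ((β ℓ : ℝ) : ℂ) * (starRingEnd ℂ) ((β ℓ' : ℝ) : ℂ) *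
            (((Nat.gcd (1 * ℓ') ℓ : ℕ) : ℝ) : ℂ) / (Real.sqrt ((ℓ : ℝ) * ℓ') : ℂ)).re with hΦ1def
  -- partial sums along `Finset.range`
  have hT' := TypeDesign.tendsto_sum_range_of_tendsto_sum_Icc_floor
    (f := fun n => (c n - ArithmeticFunction.vonMangoldt n) / n *
      (∑ ℓ ∈ Finset.Icc 1 L, ∑ ℓ' ∈ Finset.Icc 1 L, ((β ℓ : ℝ) : ℂ) * (starRingEnd ℂ) ((β ℓ' : ℝ) : ℂ) *
        (((Nat.gcd (n * ℓ') ℓ : ℕ) : ℝ) : ℂ) / (Real.sqrt ((ℓ : ℝ) * ℓ') : ℂ)).re) (by simp) hT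
  obtain ⟨hw_anti, hw_nonneg, -, hw_zero, hw_one⟩ := logRiesz_one_regular'
  refine TypeDesign.typeLimit_le_of_eventually_le hT' (fun (M : ℕ) (n : ℕ) => max (1 - Real.log n / Real.log M) 0)
    (fun M => M) hw_anti hw_nonneg hw_zero hw_one ?_
  intro ε hε
  -- the two asymptotics and the comb inequality
  have hN := stub_combNormAsymp β L hβ hL b hb hbc hbs hb0
  have hD := stub_combDiffAsymp c hc0 hM hloc β L hβ hL b hb hbc hbs hb0
  set ε₁ : ℝ := min 1 (ε / (|Φ1| + 1)) with hε₁def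
  have hε₁pos : 0 < ε₁ := lt_min one_pos (div_pos hε (by positivity))
  have hε₁le1 : ε₁ ≤ 1 := min_le_left _ _
  have hε₁le : ε₁ ≤ ε / (|Φ1| + 1) := min_le_right _ _
  obtain ⟨M₁, hM₁⟩ := combInequalityDesign c hU β L hβ hL b hb hbc hbs ε₁ hε₁pos
  set δ : ℝ := ε * B0 / 4 with hδdef
  have hδ : 0 < δ := by positivity
  have ev1 := hN.eventually_le_const (show B0 * Φ1 < B0 * Φ1 + δ by linarith)
  have ev2 := hD.eventually_const_le (show (-δ : ℝ) < 0 by linarith)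
  filter_upwards [ev1, ev2, eventually_ge_atTop M₁, eventually_ge_atTop 2] with M h1 h2 h3 h4
  have hcomb := hM₁ M h3
  -- name the three aggregates
  set R : ℝ := ∑ ℓ ∈ Finset.Icc 1 L, ∑ ℓ' ∈ Finset.Icc 1 L, β ℓ * β ℓ' *
          ∑ k' ∈ Finset.Icc 1 M,
            (∑ k ∈ Finset.Icc 1 M, (∫ u, b u * b (u - (Real.log (((1 : ℕ) : ℝ) * ℓ' * k' / ℓ) - Real.log k)
                / (Real.sqrt (Real.log M) / M))) / Real.sqrt k) / Real.sqrt k' / Real.sqrt ((1 : ℕ) : ℝ) with hRdef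
  set Dd : ℝ := (∑ ℓ ∈ Finset.Icc 1 L, ∑ ℓ' ∈ Finset.Icc 1 L, β ℓ * β ℓ' *
          ∑ n ∈ Finset.Icc 1 (3 * L * M), c n *
            ∑ k' ∈ Finset.Icc 1 M,
              (∑ k ∈ Finset.Icc 1 M, (∫ u, b u * b (u - (Real.log ((n : ℝ) * ℓ' * k' / ℓ) - Real.log k)
                  / (Real.sqrt (Real.log M) / M))) / Real.sqrt k) / Real.sqrt k' / Real.sqrt n) -
        (∑ ℓ ∈ Finset.Icc 1 L, ∑ ℓ' ∈ Finset.Icc 1 L, β ℓ * β ℓ' *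
          ∑ n ∈ Finset.Icc 1 (3 * L * M), (Λ n : ℝ) *
            ∑ k' ∈ Finset.Icc 1 M,
              (∑ k ∈ Finset.Icc 1 M, (∫ u, b u * b (u - (Real.log ((n : ℝ) * ℓ' * k' / ℓ) - Real.log k)
                  / (Real.sqrt (Real.log M) / M))) / Real.sqrt k) / Real.sqrt k' / Real.sqrt n) with hDdef
  set S : ℝ := ∑ n ∈ Finset.range M, (c n - ArithmeticFunction.vonMangoldt n) / n *
        (∑ ℓ ∈ Finset.Icc 1 L, ∑ ℓ' ∈ Finset.Icc 1 L, ((β ℓ : ℝ) : ℂ) * (starRingEnd ℂ) ((β ℓ' : ℝ) : ℂ) *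
            (((Nat.gcd (n * ℓ') ℓ : ℕ) : ℝ) : ℂ) / (Real.sqrt ((ℓ : ℝ) * ℓ') : ℂ)).re *
        max (1 - Real.log n / Real.log M) 0 with hSdef
  have hlogpos : 0 < Real.log (M : ℝ) := Real.log_pos (by exact_mod_cast h4)
  -- R ≤ (B0 Φ1 + δ) log M ;  (B0 S − δ) log M ≤ Dd ;  Dd ≤ ((1+ε₁)/2) R
  have i1 : R ≤ (B0 * Φ1 + δ) * Real.log M := (div_le_iff₀ hlogpos).1 h1
  have i2 : (B0 * S - δ) * Real.log M ≤ Dd := (le_div_iff₀ hlogpos).1 (by linarith)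
  have hk0 : (0 : ℝ) ≤ (1 + ε₁) / 2 := by positivity
  have hk1 : (1 + ε₁) / 2 ≤ 1 := by linarith
  have i3 : (B0 * S - δ) * Real.log M ≤ ((1 + ε₁) / 2 * (B0 * Φ1 + δ)) * Real.log M :=
    calc (B0 * S - δ) * Real.log M ≤ Dd := i2
      _ ≤ (1 + ε₁) / 2 * R := hcomb
      _ ≤ (1 + ε₁) / 2 * ((B0 * Φ1 + δ) * Real.log M) := mul_le_mul_of_nonneg_left i1 hk0
      _ = ((1 + ε₁) / 2 * (B0 * Φ1 + δ)) * Real.log M := by ring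
  have i4 : B0 * S - δ ≤ (1 + ε₁) / 2 * (B0 * Φ1 + δ) := le_of_mul_le_mul_right i3 hlogpos
  -- scalar bookkeeping
  have f1 : ε₁ * Φ1 ≤ ε := by
    have a1 : ε₁ * Φ1 ≤ ε₁ * |Φ1| := mul_le_mul_of_nonneg_left (le_abs_self Φ1) hε₁pos.le
    have a2 : ε₁ * |Φ1| ≤ ε / (|Φ1| + 1) * |Φ1| := mul_le_mul_of_nonneg_right hε₁le (abs_nonneg _)
    have a3 : ε / (|Φ1| + 1) * |Φ1| ≤ ε := by
      rw [div_mul_eq_mul_div, div_le_iff₀ (by positivity)]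
      nlinarith [abs_nonneg Φ1, hε.le]
    linarith
  have f2 : (1 + ε₁) / 2 * (B0 * Φ1 + δ) = 1 / 2 * (B0 * Φ1) + B0 / 2 * (ε₁ * Φ1) + (1 + ε₁) / 2 * δ := by ring
  have f3 : B0 / 2 * (ε₁ * Φ1) ≤ B0 / 2 * ε := mul_le_mul_of_nonneg_left f1 (by positivity)
  have f4 : (1 + ε₁) / 2 * δ ≤ δ := mul_le_of_le_one_left hδ.le hk1
  have i5 : B0 * S ≤ B0 * (1 / 2 * Φ1 + ε) := by
    have : B0 * (1 / 2 * Φ1 + ε) = 1 / 2 * (B0 * Φ1) + B0 / 2 * ε + 2 * (ε * B0 / 4) := by ring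
    rw [this]
    linarith
  exact le_of_mul_le_mul_left i5 hB0

/-- **`SignCone.SlackDesign` from the stubs** (composition; concludes the crux BY NAME).  The two extra hypotheses
of the crux (`L`-summability on `re s > 1`, Carathéodory majorant) are not used. [folklore] -/
theorem SlackDesign_of :
    Summit.RiemannHypothesis.RiemannHypothesis.Theses.SignCone.SlackDesign := by
  intro c hc0 hc1 hU _hsum _hF
  -- fake PNT, Chebyshev + Mertens, local summability (all landed)
  have hPNT := stub_fakePNT c hc0 hU
  have hM := stub_fakeMertens c hc0 hPNT
  have hloc := stub_combLocal c hc0 hc1 hU hM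
  -- type inequalities for every finitely supported complex design (real designs suffice, limits exist: landed)
  have hT := TypeIneq.typeOfRealLimitBound c hc0 hM.2 hloc (realLimitBound c hc0 hU hM hloc)
  -- design data with constant 1/2 (landed [CV]/W-MAG design algebra)
  refine TypeDesign.designData_of_mertens_typeBound (1 / 2) c hc0 hc1 hM.2 hloc ?_
  intro α L hα T hTa
  obtain ⟨T', hT', hle⟩ := hT α L hα
  have hTT' : T = T' := tendsto_nhds_unique hTa hT'
  rw [hTT']
  exact hle

end Summit.RiemannHypothesis.RiemannHypothesis.Cruxes.SlackDesign.RealCombType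

end
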